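import Literature.Barriers.CriticalPhenomena.LaceExpansionPcInputs
import Mathlib.MeasureTheory.Integral.Pi
import Mathlib.MeasureTheory.Integral.Prod
import Mathlib.Analysis.SpecialFunctions.Integrals.Basic
import HarnessLib

/-!
# Periodic integration by parts on the cube `[-π,π]^d` in one coordinate

Barrier catalogue `Literature/Barriers/CriticalPhenomena/` (D-0021), measure-theoretic
infrastructure for the last analytic named fact `Hara2008_lem23` (Hara 2008, Lemma 2.3), whose
proof multiplies a Fourier coefficient by `x_l` through an integration by parts in `k_l`
((2.37): `x_l F_n⃗(x) = i^{n+1} ∫ e^{ikx} ∂_l[e^{-t(1-Ĵ)} Π_j (∂_jĴ)^{n_j}] d^dk/(2π)^d`). PROVED,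
[folklore]:

* `cube_succ_eq_preimage`, `integral_cube_succ_eq_iterated` — splitting the `l`-th coordinate
  (`MeasurableEquiv.piFinSuccAbove`, measure preserving for Lebesgue measure) and Fubini: for a
  continuous `H`, `∫_{[-π,π]^{n+1}} H = ∫_{[-π,π]^n} ∫_{-π}^{π} H(ins_l(s,k')) ds dk'`;
* `integral_cube_mul_deriv_eq_neg` — for `U, G : ℝ^d → ℂ` with continuous partial derivatives
  `U', G'` in `k_l` (as `HasDerivAt (s ↦ U(k[l↦s])) (U' k) k_l`), all continuous, and `UG` equal
  on the faces `k_l = ∓π`: `∫_{cube} U ∂_lG = -∫_{cube} (∂_lU) G` (one-dimensional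
  `intervalIntegral.integral_mul_deriv_eq_deriv_mul` in the inner integral, boundary terms
  cancelling by periodicity).

## References

* T. Hara, Ann. Probab. 36 (2008) 530–593 (arXiv:math-ph/0504021): proof of Lemma 2.3, (2.37).
-/

noncomputable section

namespace Literature.Barriers.CriticalPhenomena

open MeasureTheory Filter Finset Literature.Probability.LatticeModels Literature.Probability.Percolation
open scoped Topology BigOperators

/-! ### Splitting off one coordinate of the cube -/

/-- The cube `[-π,π]^{n+1}` is the preimage of `[-π,π] × [-π,π]^n` under the splitting of the
`l`-th coordinate. [folklore] -/
theorem cube_succ_eq_preimage (n : ℕ) (l : Fin (n + 1)) :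
    cube (n + 1) = (MeasurableEquiv.piFinSuccAbove (fun _ => ℝ) l) ⁻¹'
      (Set.Icc (-Real.pi) Real.pi ×ˢ cube n) := by
  ext k
  simp only [cube, Set.mem_pi, Set.mem_univ, true_implies, Set.mem_preimage, Set.mem_prod,
    MeasurableEquiv.piFinSuccAbove_apply, Fin.insertNthEquiv, Equiv.coe_fn_symm_mk, Fin.removeNth]
  rw [Fin.forall_iff_succAbove l]

/-- **Iterated integration over the cube**: for a continuous `H`,
`∫_{[-π,π]^{n+1}} H = ∫_{[-π,π]^n} ∫_{-π}^{π} H(ins_l(s, k')) ds dk'` (`ins_l = Fin.insertNth l`).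
[folklore] -/
theorem integral_cube_succ_eq_iterated {n : ℕ} (l : Fin (n + 1)) {H : (Fin (n + 1) → ℝ) → ℂ}
    (hH : Continuous H) :
    ∫ k in cube (n + 1), H k =
      ∫ k' in cube n, ∫ s in Set.Icc (-Real.pi) Real.pi, H (Fin.insertNth l s k') := by
  set e := MeasurableEquiv.piFinSuccAbove (fun _ : Fin (n + 1) => ℝ) l with he
  have hmp : MeasurePreserving e (volume : Measure (Fin (n + 1) → ℝ))
      ((volume : Measure ℝ).prod (volume : Measure (Fin n → ℝ))) := by
    have h := measurePreserving_piFinSuccAbove (fun _ : Fin (n + 1) => (volume : Measure ℝ)) l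
    simpa [he, volume_pi] using h
  -- change of variables
  have h1 : ∫ k in cube (n + 1), H k =
      ∫ p in Set.Icc (-Real.pi) Real.pi ×ˢ cube n, H (e.symm p) ∂((volume : Measure ℝ).prod volume) := by
    rw [cube_succ_eq_preimage n l, ← he]
    rw [← hmp.setIntegral_preimage_emb e.measurableEmbedding (fun p => H (e.symm p))]
    simp only [MeasurableEquiv.symm_apply_apply]
  rw [h1, ← Measure.prod_restrict]
  -- Fubini with the `s`-integral inside
  have hsymm : ∀ p : ℝ × (Fin n → ℝ), e.symm p = Fin.insertNth l p.1 p.2 := fun p => by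
    rw [he, MeasurableEquiv.piFinSuccAbove_symm_apply]; rfl
  have hcont : Continuous fun p : ℝ × (Fin n → ℝ) => H (e.symm p) := by
    simp_rw [hsymm]
    exact hH.comp (Continuous.finInsertNth l continuous_fst continuous_snd)
  have hint : Integrable (fun p : ℝ × (Fin n → ℝ) => H (e.symm p))
      (((volume : Measure ℝ).restrict (Set.Icc (-Real.pi) Real.pi)).prod (volume.restrict (cube n))) := by
    rw [Measure.prod_restrict]
    have hK : IsCompact (Set.Icc (-Real.pi) Real.pi ×ˢ cube n) := by
      refine isCompact_Icc.prod ?_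
      unfold cube; exact isCompact_univ_pi fun _ => isCompact_Icc
    exact hcont.continuousOn.integrableOn_compact hK
  rw [integral_prod_symm _ hint]
  refine integral_congr_ae (Filter.Eventually.of_forall fun k' => ?_)
  refine integral_congr_ae (Filter.Eventually.of_forall fun s => ?_)
  show H (e.symm (s, k')) = H (l.insertNth s k')
  rw [hsymm]

/-! ### Integration by parts in one coordinate, periodic boundary -/

/-- **Periodic integration by parts on the cube** in the coordinate `l`: for `U, G` with
continuous partial derivatives `U', G'` in `k_l` (in the sense
`HasDerivAt (s ↦ U(k[l ↦ s])) (U' k) (k_l)`), all four continuous, and `UG` taking the same values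
on the two faces `k_l = ∓π`, `∫_{[-π,π]^d} U ∂_lG = -∫_{[-π,π]^d} (∂_lU) G`.
[cite: Hara2008, proof of Lemma 2.3 ((2.37): "With the help of Fourier transform")] -/
theorem integral_cube_mul_deriv_eq_neg {d : ℕ} (l : Fin d) {U U' G G' : (Fin d → ℝ) → ℂ}
    (hU : ∀ k, HasDerivAt (fun s => U (Function.update k l s)) (U' k) (k l))
    (hG : ∀ k, HasDerivAt (fun s => G (Function.update k l s)) (G' k) (k l))
    (hUc : Continuous U) (hU'c : Continuous U') (hGc : Continuous G) (hG'c : Continuous G')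
    (hper : ∀ k, U (Function.update k l (-Real.pi)) * G (Function.update k l (-Real.pi)) =
      U (Function.update k l Real.pi) * G (Function.update k l Real.pi)) :
    ∫ k in cube d, U k * G' k = -∫ k in cube d, U' k * G k := by
  -- `d = n + 1`
  obtain ⟨n, rfl⟩ : ∃ n, d = n + 1 := ⟨d - 1, by have := l.pos; omega⟩
  rw [integral_cube_succ_eq_iterated l (H := fun k => U k * G' k) (hUc.mul hG'c),
    integral_cube_succ_eq_iterated l (H := fun k => U' k * G k) (hU'c.mul hGc), ← integral_neg]
  refine integral_congr_ae (Filter.Eventually.of_forall fun k' => ?_)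
  -- the one-dimensional integration by parts at fixed `k'`
  set ins : ℝ → (Fin (n + 1) → ℝ) := fun s => Fin.insertNth l s k' with hins
  have hins_l : ∀ s, ins s l = s := fun s => by simp [hins]
  have hupd : ∀ s s', Function.update (ins s) l s' = ins s' := fun s s' => by
    simp [hins, Fin.update_insertNth]
  have hu : ∀ s, HasDerivAt (fun s => U (ins s)) (U' (ins s)) s := by
    intro s
    have h := hU (ins s)
    simp only [hupd, hins_l] at h
    exact h
  have hv : ∀ s, HasDerivAt (fun s => G (ins s)) (G' (ins s)) s := by
    intro s
    have h := hG (ins s)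
    simp only [hupd, hins_l] at h
    exact h
  have hins_c : Continuous ins := Continuous.finInsertNth l continuous_id continuous_const
  have hπ : -Real.pi ≤ Real.pi := by linarith [Real.pi_pos]
  have hibp := intervalIntegral.integral_mul_deriv_eq_deriv_mul (a := -Real.pi) (b := Real.pi)
    (u := fun s => U (ins s)) (v := fun s => G (ins s)) (u' := fun s => U' (ins s)) (v' := fun s => G' (ins s))
    (fun s _ => hu s) (fun s _ => hv s)
    ((hU'c.comp hins_c).intervalIntegrable _ _) ((hG'c.comp hins_c).intervalIntegrable _ _)
  -- the boundary terms cancel by periodicity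
  have hbd : U (ins Real.pi) * G (ins Real.pi) - U (ins (-Real.pi)) * G (ins (-Real.pi)) = 0 := by
    have h := hper (ins 0)
    rw [hupd, hupd] at h
    rw [h, sub_self]
  rw [hbd, zero_sub] at hibp
  show ∫ s in Set.Icc (-Real.pi) Real.pi, U (l.insertNth s k') * G' (l.insertNth s k') =
    -∫ s in Set.Icc (-Real.pi) Real.pi, U' (l.insertNth s k') * G (l.insertNth s k')
  rw [integral_Icc_eq_integral_Ioc, integral_Icc_eq_integral_Ioc, ← intervalIntegral.integral_of_le hπ,
    ← intervalIntegral.integral_of_le hπ]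
  simpa [hins] using hibp

end Literature.Barriers.CriticalPhenomena
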